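import Summits.ABC.IUTFork.Cor312HullGainRamifiedGlobal
import HarnessLib

/-!
# [IUTchIII] Cor. 3.12, statement — STRICT hull gain `μ^log((Ind3)-region) < −|log(Θ)|_{i+1,p}` at EVERY ramified packet of
# the print-normalised sharp setting of record, whatever the Θ-ideles there (primes under `S` included)

PROOF-ONLY sequel (abc-iut cell, Cor. 3.12 sub-crew, seat abc-iut-c312-5, gen 5; row «RAMIFIED-GAIN», sharp-box form) of
`Cor312HullGainRamified` (p439709) / `…Global` (p440607); TAKES NO SIDE on [IUTchIII] Cor. 3.12; no definition, no `Prop`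
fact, no instance. p439709 needed the prime `p` NOT to lie under `S` (unit Θ-boxes). THIS FILE removes that hypothesis:
at `Real.settingPrVolSharp` (abc-iut-c312-7) the sharp Θ-box at `(i+1, p, v⃗)` is the hull-set of coordinate radius
`‖t_{Θ,i+1,v_{i+1}}‖` (abc-iut-c312-3 `thetaBoxDH_sharp_inr`, `norm_thetaCentre_sharp`), and the argument of the parent
file runs with the moving point `p^k·z^{⊗(i+2)}` scaled INTO that box (`‖z‖^{i+2} ≤ p^k·‖t‖ < ‖g z‖^{i+2}`) and the box
CENTRE realising every coordinate radius inside the hull: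

* **`logvol_thetaRegion3_lt_thetaLocal_settingPrVolSharp_of_ramified`** — for ANY prime `p` with a place `v | p` of `F`,
  `2 ≤ e_v ≤ i+2`, and non-zero Θ-ideles: `↑μ^log_{Pr}((Ind3)-region_{i+1,p}) < −|log(Θ)|_{i+1,p}` (the ≤ is this seat's
  `logvol_thetaRegion3_le_thetaLocal_sharp_Pr` / abc-iut-c312-6 `logvol_thetaRegion_le_thetaLocal_of_mono`);
* **`neg_ndegLgp_lt_negLogTheta_settingPrVolSharp_of_ramified'`** — hence, for Θ-ideles realising `P_Θ`,
  `↑(−deĝ_lgp(P_Θ)) < −|log(Θ)|` as soon as `F` has ANY place `v` with `2 ≤ e_v ≤ i+2` for some label (no condition on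
  `S`; with `Cor312HullGainDyadic` this covers every genuine `F ∋ √−1` of dyadic ramification `≤ ℓ⋆+1`).
PACKET CENSUS of the typed hull at the sharp setting of record (neutral): at odd `p ∤ disc(F)` the local Θ-volume is EXACTLY
the region's plus the slot-minimum term (p433308); at a ramified packet with `e_v ≤ i+2` it STRICTLY exceeds the region's
(this file); ramified packets with `e_v > i+2` only: `≥` (open). HONEST SCOPE: Dupuy–Hilado's (Ind2); the sign of
`−|log(Θ)| − (−|log(q)|)` is NOT evaluated. [cite: DupuyHilado2025, §3.6, §3.9, §4.9]
[cite: Mochizuki2012, IUTchIV Thm 1.10 proof Step (v) p. 27–28] [claim: Mochizuki2012, status: disputed]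
-/

noncomputable section

open Set Function NumberField IsDedekindDomain Metric
open scoped Pointwise

namespace Summit.ABC

namespace IUTFork

namespace Thm311

namespace Real

open Cor312 Cor312.Setting Cor312Vol Literature.IUT.LogThetaLattice Literature.IUT.LogVolume

variable {F : Type} [Field F] [NumberField F] (X : PilotData F) {logv : PadicLogs F} (hlog : LogvAnalytic logv)

variable (M : Type) [Field M] [NumberField M]
  (archPk : ∀ (j : (thetaIndex X).Label) (vQ : (thetaIndex X).VQ), Set ((logShellsDH X logv).Packet j vQ))
  (archSub : ∀ (j : (thetaIndex X).Label) (v : (thetaIndex X).V),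
    Set ((logShellsDH X logv).Packet j ((thetaIndex X).over v)))
  (Ψ : ℤ → ∀ v : (thetaIndex X).V, v ∈ (thetaIndex X).Vbad → Set ((logShellsDH X logv).StarPacket v))
  (act : ℤ → ∀ v : (thetaIndex X).V, v ∈ (thetaIndex X).Vbad →
    (logShellsDH X logv).StarPacket v → Module.End ℚ ((logShellsDH X logv).StarPacket v))
  (Mmod : ℤ → ∀ j : (thetaIndex X).LabelStar, Set ((logShellsDH X logv).GlobalPacket j.1))
  (region : ℤ → ∀ j : (thetaIndex X).LabelStar, FinDivisor M → ∀ vQ : (thetaIndex X).VQ,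
    Set ((logShellsDH X logv).Packet j.1 vQ))
  (n : ℤ)
  (t : ∀ (pp : Nat.Primes) (_ : Fin X.lstar) (x : (thetaIndex X).Fibre (.inr pp)),
    haveI : Fact (pp : ℕ).Prime := ⟨pp.2⟩; kOf X pp.1 x)
  (tq : ∀ (pp : Nat.Primes) (x : (thetaIndex X).Fibre (.inr pp)),
    haveI : Fact (pp : ℕ).Prime := ⟨pp.2⟩; kOf X pp.1 x)
  {HT : Type} {LogLink : HT → HT → Type} {IsFull : ∀ {s t : HT}, LogLink s t → Prop}
  (lat : LGPGaussianLogThetaLattice LogLink IsFull)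
  {Frd : Type} {IsoF : Frd → Frd → Type} {Ob : Frd → Type} {realify : Frd → Frd} {Strip : Type}
  {IsoS : Strip → Strip → Type} {Mv : ∀ v : (thetaIndex X).V, v ∈ (thetaIndex X).Vbad → Type}
  [∀ v h, Monoid (Mv v h)]
  (sig : GlobalLGPFrobenioidSignature (thetaIndex X).lstar (thetaIndex X).V (· ∈ (thetaIndex X).Vbad)
    Frd IsoF Ob realify Strip IsoS Mv)
  (split : SplittingMonoids Mv) {ObΔ : Type} {N : ∀ v : (thetaIndex X).V, v ∈ (thetaIndex X).Vbad → Type}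
  [∀ v h, Monoid (N v h)] (qData : QPilotData ObΔ N)

open Literature.NumberTheory.NumberFields in
/-- **STRICT hull gain at a ramified packet, sharp boxes**: at `Real.settingPrVolSharp`, for ANY prime `p`, a place `v | p`
of `F` with `2 ≤ e_v ≤ |S^±_{i+2}| = i+2`, and non-zero Θ-ideles, the packet-normalised log-volume of the (Ind3)-region at
`(i+1, p)` is STRICTLY below `−|log(Θ)|_{i+1,p}`: the (Ind2)-family `⊗_a g` (a non-isometry `g ∈ Real.ismDH logv v`,
`Cor312HullGainRamified.exists_mem_ismDH_norm_lt`) carries a point of the box on the diagonal summand `(v,…,v)` (radius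
`‖t_{Θ,i+1,v}‖`) to a possible image of coordinate norms `ρ > ‖t_{Θ,i+1,v}‖`, while the box centres pin every radius of the
hull `e⁻¹(λ·𝒪_L)` from below. [cite: DupuyHilado2025, §3.9, §4.9] [claim: Mochizuki2012, status: disputed] -/
theorem logvol_thetaRegion3_lt_thetaLocal_settingPrVolSharp_of_ramified (ht0 : ∀ pp i x, t pp i x ≠ 0)
    (ht1 : ∀ (pp : Nat.Primes) (i : Fin X.lstar) (x : (thetaIndex X).Fibre (.inr pp)),
      haveI : Fact (pp : ℕ).Prime := ⟨pp.2⟩; placeOf X pp.1 x ∉ X.S → ‖t pp i x‖ = 1)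
    (htq0 : ∀ pp x, tq pp x ≠ 0)
    (htq1 : ∀ (pp : Nat.Primes) (x : (thetaIndex X).Fibre (.inr pp)),
      haveI : Fact (pp : ℕ).Prime := ⟨pp.2⟩; placeOf X pp.1 x ∉ X.S → ‖tq pp x‖ = 1)
    (i : Fin (thetaIndex X).lstar) (pp : Nat.Primes) [Fact (pp : ℕ).Prime]
    (v : HeightOneSpectrum (𝓞 F)) (hv : (thetaIndex X).over (.inr v) = .inr pp)
    (hvp : ((pp : ℕ) : 𝓞 F) ∈ v.asIdeal) (he : 2 ≤ absRamificationIdx (pp : ℕ) (RescaledCompletion F (pp : ℕ) v hvp))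
    (hei : absRamificationIdx (pp : ℕ) (RescaledCompletion F (pp : ℕ) v hvp) ≤
      Fintype.card ((thetaIndex X).Caps (Setting.labelSucc i))) :
    ((((situationPrVol X hlog M archPk archSub Ψ act Mmod region).D n).logvol (Setting.labelSucc i) (.inr pp)
        ((settingPrVolSharp X hlog M archPk archSub Ψ act Mmod region n lat sig split qData tq t htq0
          htq1).thetaRegion3 (Setting.labelSucc i) (.inr pp)) : ℝ) : WithTop ℝ) <
      (settingPrVolSharp X hlog M archPk archSub Ψ act Mmod region n lat sig split qData tq t htq0
        htq1).thetaLocal (Setting.labelSucc i) (.inr pp) := by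
  classical
  have hp1 : (1 : ℝ) < (pp : ℕ) := by exact_mod_cast pp.2.one_lt
  have hp0 : (0 : ℝ) < (pp : ℕ) := zero_lt_one.trans hp1
  set x₀ : (thetaIndex X).Fibre (.inr pp) := ⟨.inr v, hv⟩ with hx₀
  set e₀ : (thetaIndex X).Caps (Setting.labelSucc i) → (thetaIndex X).Fibre (.inr pp) := fun _ => x₀ with he₀
  set Pset := settingPrVolSharp X hlog M archPk archSub Ψ act Mmod region n lat sig split qData tq t htq0 htq1
    with hPset
  haveI : Nonempty ((thetaIndex X).Caps (Setting.labelSucc i)) := ⟨0⟩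
  -- the box radius at the diagonal summand: `τ = ‖t_{Θ,i+1,v}‖ > 0`
  have hτ : 0 < ‖t pp i x₀‖ := norm_pos_iff.mpr (ht0 pp i x₀)
  -- §1: the mover at `v`
  obtain ⟨g, hg, g', hgg', z, hz⟩ := exists_mem_ismDH_norm_lt X hlog pp v hv hvp he
  have hz0 : z ≠ 0 := fun h0 => by
    rw [h0, map_zero, norm_zero] at hz
    exact lt_irrefl _ hz
  have hzN : 0 < ‖z‖ ^ Fintype.card ((thetaIndex X).Caps (Setting.labelSucc i)) / ‖t pp i x₀‖ :=
    div_pos (pow_pos (norm_pos_iff.mpr hz0) _) hτ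
  have hratio := rpow_mul_norm_le_of_norm_lt (pp : ℕ) (K := (presAt X hlog pp).k x₀) hz
  have hpow : ((pp : ℕ) : ℝ) * (‖z‖ ^ Fintype.card ((thetaIndex X).Caps (Setting.labelSucc i)) / ‖t pp i x₀‖) ≤
      ‖g' z‖ ^ Fintype.card ((thetaIndex X).Caps (Setting.labelSucc i)) / ‖t pp i x₀‖ := by
    rw [← mul_div_assoc]
    exact div_le_div_of_nonneg_right
      (p_mul_pow_norm_le (pp : ℕ) (absRamificationIdx_pos (pp : ℕ) ((presAt X hlog pp).k x₀)) hei hratio) hτ.le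
  obtain ⟨k, hk1, hk2⟩ := exists_zpow_mem_window (pp : ℕ) hzN hpow
  have hnk : ‖((pp : ℕ) : ℚ_[pp]) ^ k‖ = ((pp : ℕ) : ℝ) ^ (-k) := by
    rw [norm_zpow, Padic.norm_p, inv_zpow']
  set ρ : ℝ := ((pp : ℕ) : ℝ) ^ (-k) * ‖g' z‖ ^ Fintype.card ((thetaIndex X).Caps (Setting.labelSucc i)) with hρ
  have hρτ : ‖t pp i x₀‖ < ρ := by
    rw [hρ, zpow_neg, ← div_eq_inv_mul, lt_div_iff₀ (zpow_pos hp0 k), ← lt_div_iff₀' hτ]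
    exact hk2
  have hbox : ((pp : ℕ) : ℝ) ^ (-k) * ‖z‖ ^ Fintype.card ((thetaIndex X).Caps (Setting.labelSucc i)) ≤ ‖t pp i x₀‖ := by
    rw [zpow_neg, ← div_eq_inv_mul, div_le_iff₀ (zpow_pos hp0 k), ← div_le_iff₀' hτ]
    exact hk1
  -- §2a: the (Ind2)-family acting by `g` at `v` (every slot) and trivially elsewhere
  set G : ∀ y : Place F, Carrier y ≃ₗ[ℚ] Carrier y :=
    Function.update (fun y => LinearEquiv.refl ℚ (Carrier y)) (.inr v) g with hG
  have hGv : G (.inr v) = g := by rw [hG, Function.update_self]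
  have hGmem : ∀ y : Place F, G y ∈ ismDH logv y := by
    intro y
    by_cases hy : y = .inr v
    · subst hy; rw [hGv]; exact hg
    · rw [hG, Function.update_of_ne hy]; exact refl_mem_ismDH logv y
  choose g'' hg'' using fun w : (thetaIndex X).Fibre (.inr pp) => (presAt X hlog pp).ism_linear w (G w.1) (hGmem w.1)
  set Φ : (logShellsDH X logv).PacketAut := fun j' vQ' =>
    (logShellsDH X logv).factorwise j' vQ' fun _ => (logShellsDH X logv).summandwise vQ' fun w => G w.1 with hΦ
  have hΦ2 : Φ ∈ (logShellsDH X logv).Ind2Family := fun j' vQ' => ⟨fun _ w => G w.1, fun _ w => hGmem w.1, rfl⟩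
  have hΦind : Φ ∈ Setting.indGroup (situationPrVol X hlog M archPk archSub Ψ act Mmod region) :=
    Subgroup.subset_closure (Or.inr hΦ2)
  have hcomp : ∀ x, (presAt X hlog pp).comparison (Setting.labelSucc i) (Φ (Setting.labelSucc i) (.inr pp) x) =
      fun e => (PiTensorProduct.congr fun a => g'' (e a) : (presAt X hlog pp).X e ≃ₗ[ℚ_[pp]] (presAt X hlog pp).X e)
        ((presAt X hlog pp).comparison (Setting.labelSucc i) x e) :=
    fun x => (presAt X hlog pp).comparison_factorwise (fun _ w => G w.1) (fun _ w => g'' w) (fun _ w y => hg'' w y) x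
  have hGx : ∀ y, G x₀.1 y = g y := fun y => by
    change G (.inr v) y = g y
    rw [hGv]
  have hagree : ∀ u, g'' x₀ u = g' u := by
    intro u
    obtain ⟨y, rfl⟩ := ((presAt X hlog pp).φ x₀).surjective u
    rw [← hg'' x₀ y, ← hgg' y]
    exact congrArg _ (hGx y)
  -- §2b: the point `w = p^k·z^{⊗N}` of the box and its image
  set u : (presAt X hlog pp).X e₀ := purePacket (pp : ℕ) ((presAt X hlog pp).kk e₀) fun _ => z with hu
  set w : (presAt X hlog pp).X e₀ := (((pp : ℕ) : ℚ_[pp]) ^ k) • u with hw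
  have hnorm_u : ∀ jj : DIdx (pp : ℕ) ((presAt X hlog pp).kk e₀), ‖dEquiv (pp : ℕ) ((presAt X hlog pp).kk e₀) u jj‖ =
      ‖z‖ ^ Fintype.card ((thetaIndex X).Caps (Setting.labelSucc i)) := by
    intro jj
    rw [hu, psi_purePacket_apply (pp : ℕ) ((presAt X hlog pp).kk e₀) (DFac (pp : ℕ) ((presAt X hlog pp).kk e₀))
      (dEquiv (pp : ℕ) ((presAt X hlog pp).kk e₀)), norm_prod]
    exact Finset.prod_eq_pow_card fun a _ =>
      norm_factorEmb (pp : ℕ) ((presAt X hlog pp).kk e₀) (DFac (pp : ℕ) ((presAt X hlog pp).kk e₀))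
        (dEquiv (pp : ℕ) ((presAt X hlog pp).kk e₀)) a jj _
  have hnorm_w : ∀ jj : DIdx (pp : ℕ) ((presAt X hlog pp).kk e₀), ‖dEquiv (pp : ℕ) ((presAt X hlog pp).kk e₀) w jj‖ =
      ((pp : ℕ) : ℝ) ^ (-k) * ‖z‖ ^ Fintype.card ((thetaIndex X).Caps (Setting.labelSucc i)) := by
    intro jj
    rw [hw, map_smul, Pi.smul_apply, norm_smul, hnk, hnorm_u]
  have hgu : (PiTensorProduct.congr fun a => g'' (e₀ a) :
        (presAt X hlog pp).X e₀ ≃ₗ[ℚ_[pp]] (presAt X hlog pp).X e₀) u =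
      purePacket (pp : ℕ) ((presAt X hlog pp).kk e₀) fun _ => g' z := by
    rw [hu, purePacket, purePacket, PiTensorProduct.congr_tprod]
    exact congrArg _ (funext fun a => hagree z)
  have hnorm_gw : ∀ jj : DIdx (pp : ℕ) ((presAt X hlog pp).kk e₀),
      ‖dEquiv (pp : ℕ) ((presAt X hlog pp).kk e₀) ((PiTensorProduct.congr fun a => g'' (e₀ a) :
        (presAt X hlog pp).X e₀ ≃ₗ[ℚ_[pp]] (presAt X hlog pp).X e₀) w) jj‖ = ρ := by
    intro jj
    rw [hw, map_smul, hgu, map_smul, Pi.smul_apply, norm_smul, hnk,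
      psi_purePacket_apply (pp : ℕ) ((presAt X hlog pp).kk e₀) (DFac (pp : ℕ) ((presAt X hlog pp).kk e₀))
        (dEquiv (pp : ℕ) ((presAt X hlog pp).kk e₀)), norm_prod, hρ]
    exact congrArg _ (Finset.prod_eq_pow_card fun a _ =>
      norm_factorEmb (pp : ℕ) ((presAt X hlog pp).kk e₀) (DFac (pp : ℕ) ((presAt X hlog pp).kk e₀))
        (dEquiv (pp : ℕ) ((presAt X hlog pp).kk e₀)) a jj _)
  -- §2c: the (Ind3)-region at `(i+1, p)` is the hull-set with the Θ-centre `c₀`, `‖c₀_{(v⃗,j)}‖ = ‖t_{Θ,i+1,v_{i+1}}‖`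
  obtain ⟨c₀, hc₀⟩ : ∃ c₀ : ∀ s : (presAt X hlog pp).factorIdx (Setting.labelSucc i),
      (presAt X hlog pp).factorField (Setting.labelSucc i) s,
      c₀ = (presAt X hlog pp).centreOf fun e => iota pp.1 ((presAt X hlog pp).kk e) (Fin.last _)
        (labelIdele X t pp (Setting.labelSucc i) (e (Fin.last _))) := ⟨_, rfl⟩
  have hc₀norm : ∀ (e : (thetaIndex X).Caps (Setting.labelSucc i) → (thetaIndex X).Fibre (.inr pp))
      (jj : DIdx (pp : ℕ) ((presAt X hlog pp).kk e)), ‖c₀ ⟨e, jj⟩‖ = ‖t pp i (e (Fin.last _))‖ := by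
    intro e jj
    rw [hc₀, norm_thetaCentre_sharp, labelIdele_labelSucc]
  have hc₀ne : ∀ s, c₀ s ≠ 0 := by
    rw [hc₀]
    exact thetaCentre_sharp_ne_zero X hlog t ht0 pp (Setting.labelSucc i)
  have h3 : Pset.thetaRegion3 (Setting.labelSucc i) (.inr pp) =
      (fun x => (presAt X hlog pp).factorMap (Setting.labelSucc i) x) ⁻¹'
        hullSet ((presAt X hlog pp).factorField (Setting.labelSucc i)) c₀ := by
    rw [hPset, settingPrVolSharp, thetaRegion3_settingPrVol, iUnion_thetaBoxDH_sharp, thetaBoxDH_sharp_inr X hlog t ht0,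
      hc₀]
    rfl
  have hmem3 : ∀ y : (logShellsDH X logv).Packet (Setting.labelSucc i) (.inr pp),
      y ∈ Pset.thetaRegion3 (Setting.labelSucc i) (.inr pp) ↔ ∀ e jj,
        ‖dEquiv (pp : ℕ) ((presAt X hlog pp).kk e) ((presAt X hlog pp).comparison (Setting.labelSucc i) y e) jj‖ ≤
          ‖c₀ ⟨e, jj⟩‖ := by
    intro y
    rw [h3]
    change (presAt X hlog pp).factorMap (Setting.labelSucc i) y ∈
      hullSet ((presAt X hlog pp).factorField (Setting.labelSucc i)) c₀ ↔ _
    rw [hullSet, mem_polydisc]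
    exact ⟨fun h e jj => h ⟨e, jj⟩, fun h s => h s.1 s.2⟩
  obtain ⟨x, hx⟩ := (presAt X hlog pp).comparison_surjective (Setting.labelSucc i) (Pi.single e₀ w)
  have hx3 : x ∈ Pset.thetaRegion3 (Setting.labelSucc i) (.inr pp) := by
    refine (hmem3 x).mpr fun e jj => ?_
    rw [hx]
    by_cases hee : e = e₀
    · subst hee
      rw [Pi.single_eq_same, hnorm_w, hc₀norm]
      exact hbox
    · rw [Pi.single_eq_of_ne hee, map_zero, Pi.zero_apply, norm_zero]
      exact norm_nonneg _
  -- the CENTRE point of the box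
  obtain ⟨x₁, hx₁⟩ := (presAt X hlog pp).comparison_surjective (Setting.labelSucc i)
    (fun e => (dEquiv (pp : ℕ) ((presAt X hlog pp).kk e)).symm fun jj => c₀ ⟨e, jj⟩)
  have hx₁3 : x₁ ∈ Pset.thetaRegion3 (Setting.labelSucc i) (.inr pp) := by
    refine (hmem3 x₁).mpr fun e jj => ?_
    simp only [hx₁, AlgEquiv.apply_symm_apply, le_refl]
  -- §2d: the hull is a hull-set `e⁻¹(λ·𝒪_L)` containing both points
  have hHD := hullDefined_settingPrVolSharp X hlog M archPk archSub Ψ act Mmod region n t tq lat sig split qData ht0 ht1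
    htq0 htq1 i (.inr pp)
  have hmemHul : Pset.thetaHull (Setting.labelSucc i) (.inr pp) ∈
      ((HullFrame.ofLocalFields (factorFieldDH X hlog (Setting.labelSucc i) (.inr pp))).comap
        (factorMapDH X hlog (Setting.labelSucc i) (.inr pp))).Hul :=
    (Pset.frame (Setting.labelSucc i) (.inr pp)).hull_mem_of_hasHull hHD.1 hHD.2
  obtain ⟨H', ⟨c, hc0, rfl⟩, hEq⟩ := hmemHul
  have hsub : ⋃₀ Pset.possibleImages (Setting.labelSucc i) (.inr pp) ⊆ Pset.thetaHull (Setting.labelSucc i) (.inr pp) :=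
    (Pset.frame (Setting.labelSucc i) (.inr pp)).subset_hull _
  have hmemc : ∀ y ∈ Pset.thetaHull (Setting.labelSucc i) (.inr pp), ∀ e jj,
      ‖dEquiv (pp : ℕ) ((presAt X hlog pp).kk e) ((presAt X hlog pp).comparison (Setting.labelSucc i) y e) jj‖ ≤
        ‖c ⟨e, jj⟩‖ := by
    intro y hy e jj
    rw [hEq] at hy
    change factorMapDH X hlog (Setting.labelSucc i) (.inr pp) y ∈
      hullSet (factorFieldDH X hlog (Setting.labelSucc i) (.inr pp)) c at hy
    rw [hullSet, mem_polydisc] at hy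
    exact hy ⟨e, jj⟩
  -- the centre point: every radius of the hull dominates the box radius
  have hc1 : ∀ (e : (thetaIndex X).Caps (Setting.labelSucc i) → (thetaIndex X).Fibre (.inr pp))
      (jj : DIdx (pp : ℕ) ((presAt X hlog pp).kk e)), ‖c₀ ⟨e, jj⟩‖ ≤ ‖c ⟨e, jj⟩‖ := by
    intro e jj
    have h := hmemc x₁ (hsub (Pset.thetaRegion3_subset_sUnion (Setting.labelSucc i) (.inr pp) hx₁3)) e jj
    simp only [hx₁, AlgEquiv.apply_symm_apply] at h
    exact h
  -- the image point: the radii on the diagonal summand are `≥ ρ > ‖c₀‖`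
  have himg : Φ (Setting.labelSucc i) (.inr pp) '' Pset.thetaRegion3 (Setting.labelSucc i) (.inr pp) ∈
      Pset.possibleImages (Setting.labelSucc i) (.inr pp) := ⟨Φ, hΦind, rfl⟩
  have hcρ : ∀ jj : DIdx (pp : ℕ) ((presAt X hlog pp).kk e₀), ρ ≤ ‖c ⟨e₀, jj⟩‖ := by
    intro jj
    have hΦx : Φ (Setting.labelSucc i) (.inr pp) x ∈ ⋃₀ Pset.possibleImages (Setting.labelSucc i) (.inr pp) :=
      Set.subset_sUnion_of_mem himg (Set.mem_image_of_mem _ hx3)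
    have h := hmemc _ (hsub hΦx) e₀ jj
    simp only [hcomp x, hx, Pi.single_eq_same, hnorm_gw] at h
    exact h
  -- §2e: the two volumes in the probability-weighted container
  unfold Setting.thetaLocal
  rw [if_pos hHD, hEq, h3, WithTop.coe_lt_coe]
  have hvol := (presAtPr X hlog pp).sum_w_packetLogμ_factorMap_preimage_hullSet (Setting.labelSucc i) c hc0
  have hvol₀ := (presAtPr X hlog pp).sum_w_packetLogμ_factorMap_preimage_hullSet (Setting.labelSucc i) c₀ hc₀ne
  change ((situationPrVol X hlog M archPk archSub Ψ act Mmod region).D n).logvol (Setting.labelSucc i) (.inr pp)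
      ((fun x => (presAtPr X hlog pp).factorMap (Setting.labelSucc i) x) ⁻¹'
        hullSet ((presAtPr X hlog pp).factorField (Setting.labelSucc i)) c) = _ at hvol
  change ((situationPrVol X hlog M archPk archSub Ψ act Mmod region).D n).logvol (Setting.labelSucc i) (.inr pp)
      ((fun x => (presAtPr X hlog pp).factorMap (Setting.labelSucc i) x) ⁻¹'
        hullSet ((presAtPr X hlog pp).factorField (Setting.labelSucc i)) c₀) = _ at hvol₀
  change ((situationPrVol X hlog M archPk archSub Ψ act Mmod region).D n).logvol (Setting.labelSucc i) (.inr pp)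
      ((fun x => (presAtPr X hlog pp).factorMap (Setting.labelSucc i) x) ⁻¹'
        hullSet ((presAtPr X hlog pp).factorField (Setting.labelSucc i)) c₀) <
    ((situationPrVol X hlog M archPk archSub Ψ act Mmod region).D n).logvol (Setting.labelSucc i) (.inr pp)
      ((fun x => (presAtPr X hlog pp).factorMap (Setting.labelSucc i) x) ⁻¹'
        hullSet ((presAtPr X hlog pp).factorField (Setting.labelSucc i)) c)
  rw [hvol, hvol₀]
  -- termwise `≤` (radii `‖c₀‖ ≤ ‖λ‖`), strict on the diagonal summand (`‖c₀‖ = ‖t‖ < ρ ≤ ‖λ‖`, positive coefficients)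
  have hcoef : ∀ (e : (presAtPr X hlog pp).toLocalPieces.E (Setting.labelSucc i))
      (jj : DIdx (pp : ℕ) ((presAtPr X hlog pp).kk e)), 0 < (presAtPr X hlog pp).w (Setting.labelSucc i) e *
        ((packetDegree (pp : ℕ) (DFac (pp : ℕ) ((presAtPr X hlog pp).kk e)) : ℝ)⁻¹ *
          ((absRamificationIdx (pp : ℕ) (DFac (pp : ℕ) ((presAtPr X hlog pp).kk e) jj) : ℝ) *
            (residueDegree (pp : ℕ) (DFac (pp : ℕ) ((presAtPr X hlog pp).kk e) jj) : ℝ))) :=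
    fun e jj => mul_pos (weightPr_pos X pp.1 _ e) (mul_pos (inv_pos.mpr (by exact_mod_cast packetDegree_pos _ _))
      (mul_pos (by exact_mod_cast absRamificationIdx_pos _ _) (by exact_mod_cast residueDegree_pos _ _)))
  have hle : ∀ (e : (presAtPr X hlog pp).toLocalPieces.E (Setting.labelSucc i))
      (jj : DIdx (pp : ℕ) ((presAtPr X hlog pp).kk e)), Real.log ‖c₀ ⟨e, jj⟩‖ ≤ Real.log ‖c ⟨e, jj⟩‖ :=
    fun e jj => Real.log_le_log (norm_pos_iff.mpr (hc₀ne ⟨e, jj⟩)) (hc1 e jj)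
  refine Finset.sum_lt_sum (fun e _ => Finset.sum_le_sum fun jj _ => mul_le_mul_of_nonneg_left (hle e jj) (hcoef e jj).le)
    ⟨e₀, @Finset.mem_univ _ ((presAtPr X hlog pp).toLocalPieces.instFintype (Setting.labelSucc i)) e₀, ?_⟩
  refine Finset.sum_lt_sum (fun jj _ => mul_le_mul_of_nonneg_left (hle e₀ jj) (hcoef e₀ jj).le)
    ⟨Classical.arbitrary _, Finset.mem_univ _, mul_lt_mul_of_pos_left ?_ (hcoef e₀ _)⟩
  exact Real.log_lt_log (norm_pos_iff.mpr (hc₀ne _)) ((hc₀norm e₀ _).trans_lt (hρτ.trans_le (hcρ _)))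

open Literature.NumberTheory.NumberFields in
/-- **`−deĝ_lgp(P_Θ) < −|log(Θ)|` STRICTLY at the print-normalised sharp setting of record, NO condition on `S`**: for
Θ-ideles realising `P_Θ` (units off `S`) it suffices that `F` has a place `v` (over any prime `p`) with `2 ≤ e_v ≤ i+2` for
some label `i+1` — abc-iut-c312-7's `≤` (p426498) is strict because at `(i+1, p)` the Kummer image is strictly smaller in
volume than the hull (`logvol_thetaRegion3_lt_thetaLocal_settingPrVolSharp_of_ramified`). The `S`-free form of
`neg_ndegLgp_lt_negLogTheta_settingPrVolSharp_of_ramified`. [cite: DupuyHilado2025, §3.9, §4.9, Thm. 3.10.1]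
[claim: Mochizuki2012, status: disputed] -/
theorem neg_ndegLgp_lt_negLogTheta_settingPrVolSharp_of_ramified' (ht0 : ∀ pp i x, t pp i x ≠ 0)
    (ht1 : ∀ (pp : Nat.Primes) (i : Fin X.lstar) (x : (thetaIndex X).Fibre (.inr pp)),
      haveI : Fact (pp : ℕ).Prime := ⟨pp.2⟩; placeOf X pp.1 x ∉ X.S → ‖t pp i x‖ = 1)
    (ht : ∀ (pp : Nat.Primes) (i : Fin X.lstar) (x : (thetaIndex X).Fibre (.inr pp)),
      haveI : Fact (pp : ℕ).Prime := ⟨pp.2⟩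
      Real.log ‖t pp i x‖ = -(X.thetaPilot i (placeOf X pp.1 x)) * logNorm F (placeOf X pp.1 x) /
        localDegree F (placeOf X pp.1 x))
    (htq0 : ∀ pp x, tq pp x ≠ 0)
    (htq1 : ∀ (pp : Nat.Primes) (x : (thetaIndex X).Fibre (.inr pp)),
      haveI : Fact (pp : ℕ).Prime := ⟨pp.2⟩; placeOf X pp.1 x ∉ X.S → ‖tq pp x‖ = 1)
    (i : Fin (thetaIndex X).lstar) (pp : Nat.Primes) [Fact (pp : ℕ).Prime]
    (v : HeightOneSpectrum (𝓞 F)) (hv : (thetaIndex X).over (.inr v) = .inr pp)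
    (hvp : ((pp : ℕ) : 𝓞 F) ∈ v.asIdeal) (he : 2 ≤ absRamificationIdx (pp : ℕ) (RescaledCompletion F (pp : ℕ) v hvp))
    (hei : absRamificationIdx (pp : ℕ) (RescaledCompletion F (pp : ℕ) v hvp) ≤
      Fintype.card ((thetaIndex X).Caps (Setting.labelSucc i))) :
    (((-LgpDivisor.ndegLgp X.thetaPilot : ℝ)) : WithTop ℝ) <
      (settingPrVolSharp X hlog M archPk archSub Ψ act Mmod region n lat sig split qData tq t htq0 htq1).negLogTheta := by
  have hfin := thetaFinite_settingPrVolSharp X hlog M archPk archSub Ψ act Mmod region n lat sig split qData t tq ht0 ht1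
    htq0 htq1
  have hadm := thetaRegionsAdm_settingPrVolSharp X hlog M archPk archSub Ψ act Mmod region n lat sig split qData t tq ht0
    htq0 htq1
  have hmono := logvolMono_settingPrVol X hlog M archPk archSub Ψ act Mmod region n lat sig split qData
    (fun _ _ => thetaBoxDH X hlog (sharpBoxDH X hlog t)) (fun _ => qCentreDH X hlog tq)
    (qCentreDH_ne_zero X hlog tq htq0)
    (finite_support_logvol_qRegion_Pr X hlog M archPk archSub Ψ act Mmod region n tq htq0 htq1)
  unfold Setting.negLogTheta
  rw [if_pos hfin, WithTop.coe_lt_coe,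
    ← processionNormalized_thetaRegion_settingPrVolSharp X hlog M archPk archSub Ψ act Mmod region n lat sig split qData
      t ht0 ht tq htq0 htq1 (fun _ _ => 0)]
  refine processionNormalized_lt_of_le_of_lt i.pos (fun i' => finsum_le_finsum'
    (finite_support_logvol_thetaRegion_sharp_Pr X hlog M archPk archSub Ψ act Mmod region n lat sig split qData t ht0 ht
      _ _ _ 0 i')
    (hfin.2 i') fun vQ => logvol_thetaRegion_le_thetaLocal_of_mono hmono hfin hadm 0 i' vQ) (i₀ := i) ?_
  refine finsum_lt_finsum_of_le_of_lt
    (finite_support_logvol_thetaRegion_sharp_Pr X hlog M archPk archSub Ψ act Mmod region n lat sig split qData t ht0 ht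
      _ _ _ 0 i)
    (hfin.2 i) (fun vQ => logvol_thetaRegion_le_thetaLocal_of_mono hmono hfin hadm 0 i vQ) (i₀ := .inr pp) ?_
  -- at `(i+1, p)`: the Kummer image at position `0` IS the (Ind3)-region, strictly smaller in volume than the hull
  have hreg : (settingPrVolSharp X hlog M archPk archSub Ψ act Mmod region n lat sig split qData tq t htq0
        htq1).thetaRegion 0 (Setting.labelSucc i) (.inr pp) =
      (settingPrVolSharp X hlog M archPk archSub Ψ act Mmod region n lat sig split qData tq t htq0
        htq1).thetaRegion3 (Setting.labelSucc i) (.inr pp) :=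
    Set.ext fun y => ⟨fun h => Set.mem_iUnion.mpr ⟨0, h⟩, fun h => by
      obtain ⟨m', hm'⟩ := Set.mem_iUnion.mp h
      exact hm'⟩
  have hlt := logvol_thetaRegion3_lt_thetaLocal_settingPrVolSharp_of_ramified X hlog M archPk archSub Ψ act Mmod region n t
    tq lat sig split qData ht0 ht1 htq0 htq1 i pp v hv hvp he hei
  obtain ⟨r, hr⟩ := WithTop.ne_top_iff_exists.mp (hfin.1 i (.inr pp))
  rw [← hr, WithTop.coe_lt_coe] at hlt
  rw [hreg, ← hr, WithTop.untopD_coe]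
  exact hlt

end Real

end Thm311

end IUTFork

end Summit.ABC

end
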